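import Mathlib
import HarnessLib
import Summits.HubbardSuperconductivity.HubbardSuperconductivity.Theorems.ComplexGFFStiffnessHypACumulantHolomorphicNextKStep
import Literature.MathematicalPhysics.StatisticalMechanics.ActivityExtension

/-!
# Crux `HypACumulant`, children `H1bcStatement` / `F4StatementOfCores` — the renormalisation map along an
# ENTIRE FAMILY of activities (multiplicative extensions of complex-affine lines), pointwise holomorphy

Route `route-HubbardSuperconductivity-ComplexGFFStiffness`, crux stmt-HubbardSuperconductivity-19154
(`HypACumulant`), children stmt-…-27380 (`H1bcStatement`, slot `H1σ2`) and stmt-…-27379 (slot `F4l'`).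
The landed structural pass `…HolomorphicNextKStep.differentiableOn_nextKStep_line` treats activity families
AFFINE in the parameter, `K + σV`.  The map `S_k` of the fine-tuning engine (`rgSQ`) feeds `nextKStep` with the
MULTIPLICATIVE EXTENSION `mulExt y` of a connected-polymer activity `y` ([ABKM19] (6.35)), which along a line
`y = a + σ b` is a POLYNOMIAL in `σ` (a product over connected components).  This file redoes the three steps of the
structural pass for a general family `σ ↦ 𝒦_σ` that is entire in `σ` pointwise and affine on the reference block:

* `tayNorm_const_mul`, `WeakNormLE.const_mul` — `‖c·K‖ = ‖c‖·‖K‖` for complex constants (the line has complex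
  parameter);
* the complex-affine line of activities `a + σ • b` and its admissibility (`contDiff_lineAct`, `isGaugeLocal_lineAct`, `transInv_lineAct`,
  `weakNormLE_lineAct`), `differentiable_mulExt_lineAct` (entire), `mulExt_lineAct_B₀` (affine on a connected block);
* `differentiable_midK_family`, `differentiableOn_nextK_family` (integrability hypotheses only on `s`-polymers),
  `nextH_congr_B₀`, `nextH_family`, **`differentiableOn_nextKStep_family`** — `σ ↦ nextKStep D (H + σU) (𝒦_σ) U' φ` is
  holomorphic on the disc, given measurability and a `σ`-uniform integrable bound of the intermediate functional on
  `s`-polymers (discharged for the torus data in the sequel file).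

All proved, no `sorry`.  Honest scope: toolchain for the state-regularity slots of a rung route (stiffness of a complex
Gaussian gradient field via the [ABKM19] RG); nothing about superconductivity in the Hubbard model.

## References
* S. Adams, S. Buchholz, R. Kotecký, S. Müller, arXiv:1910.13564, Definition 6.5 (6.32)–(6.35), Theorem 6.8
  [AdamsBuchholzKoteckyMuller2019].
-/

noncomputable section

-- `Summit.<Summit>.<Problem>`: single-conjunct summit, the duplicate component is mandated (D-0017).
set_option linter.dupNamespace false

namespace Summit.HubbardSuperconductivity.HubbardSuperconductivity.Theorems.ComplexGFF

open MeasureTheory Metric Set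
open Literature.MathematicalPhysics.StatisticalMechanics.GradientRG
open Literature.MathematicalPhysics.StatisticalMechanics.TorusPolymer (bprod blocks pcirc polys reblock IsPolymer mem_polys
  blockOf isConn_blockOf)
open Literature.Barriers.CriticalPhenomena.LongRangePhi4.Polymer (IsConn components)
open Literature.MathematicalPhysics.StatisticalMechanics

/-! ## Complex constants in the Taylor / weak norms -/

section ConstMul

variable {E V : Type*} [NormedAddCommGroup E] [NormedSpace ℝ E] [FiniteDimensional ℝ E] [NormedAddCommGroup V]
  [NormedSpace ℝ V]

/-- `‖c·F‖_{T_φ} = ‖c‖ ‖F‖_{T_φ}` for a complex constant `c` and a `C^{r₀}` functional `F`. -/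
theorem tayNorm_const_mul (T : E →ₗ[ℝ] V) {r₀ : ℕ} {F : E → ℂ} (hF : ContDiff ℝ r₀ F) (c : ℂ) (φ : E) :
    tayNorm T r₀ (fun ψ => c * F ψ) φ = ‖c‖ * tayNorm T r₀ F φ := by
  unfold tayNorm
  rw [Finset.mul_sum]
  refine Finset.sum_congr rfl fun s hs => ?_
  have hs' : (s : WithTop ℕ∞) ≤ r₀ := by
    exact_mod_cast Nat.lt_succ_iff.1 (Finset.mem_range.1 hs)
  have e : gaugeLift T (fun ψ => c * F ψ) = c • gaugeLift T F := by
    funext w; simp [gaugeLift_apply, smul_eq_mul]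
  rw [e, iteratedFDeriv_const_smul_apply (((contDiff_gaugeLift T hF).of_le hs').contDiffAt), norm_smul]
  ring

/-- `‖c·K‖_{T,w} ≤ ‖c‖ C` for `‖K‖_{T,w} ≤ C`. -/
theorem tayNormLE_const_mul {T : E →ₗ[ℝ] V} {r₀ : ℕ} {w : E → ℝ} {K : E → ℂ} {C : ℝ}
    (h : TayNormLE T r₀ w K C) (hK : ContDiff ℝ r₀ K) (c : ℂ) :
    TayNormLE T r₀ w (fun ψ => c * K ψ) (‖c‖ * C) := fun φ => by
  rw [tayNorm_const_mul T hK c φ, mul_assoc]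
  exact mul_le_mul_of_nonneg_left (h φ) (norm_nonneg c)

end ConstMul

variable {d M : ℕ}

/-! ## Complex-affine lines of activities -/

/-- Unfolding the complex-affine line of activities `a + σ • b`. -/
theorem lineAct_apply (a b : Finset (Fin d → ZMod M) → ((Fin d → ZMod M) → ℝ) → ℂ) (σ : ℂ)
    (Y : Finset (Fin d → ZMod M)) (ψ : (Fin d → ZMod M) → ℝ) : (a + σ • b) Y ψ = a Y ψ + σ * b Y ψ := rfl

/-- At `σ = 0` the line is `a`. -/
theorem lineAct_zero (a b : Finset (Fin d → ZMod M) → ((Fin d → ZMod M) → ℝ) → ℂ) : a + (0 : ℂ) • b = a := by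
  rw [zero_smul, add_zero]

/-- Each member of the line is translation invariant when `a, b` are. -/
theorem transInv_lineAct {s : ℕ} {a b : Finset (Fin d → ZMod M) → ((Fin d → ZMod M) → ℝ) → ℂ}
    (ha : TransInv s a) (hb : TransInv s b) (σ : ℂ) : TransInv s ((a + σ • b)) :=
  fun v hv X φ => by
    rw [lineAct_apply, lineAct_apply, ha v hv X φ, hb v hv X φ]

/-- `σ ↦ (a + σ b)(Y, ψ)` is entire. -/
theorem differentiable_lineAct (a b : Finset (Fin d → ZMod M) → ((Fin d → ZMod M) → ℝ) → ℂ)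
    (Y : Finset (Fin d → ZMod M)) (ψ : (Fin d → ZMod M) → ℝ) :
    Differentiable ℂ (fun σ : ℂ => (a + σ • b) Y ψ) :=
  (differentiable_const _).add (differentiable_id.mul (differentiable_const _))

variable [NeZero M]

/-- Each member of the line is `C^n` when `a, b` are. -/
theorem contDiff_lineAct {n : ℕ} {a b : Finset (Fin d → ZMod M) → ((Fin d → ZMod M) → ℝ) → ℂ}
    (ha : ∀ Y, ContDiff ℝ n (a Y)) (hb : ∀ Y, ContDiff ℝ n (b Y)) (σ : ℂ) (Y : Finset (Fin d → ZMod M)) :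
    ContDiff ℝ n ((a + σ • b) Y) :=
  (ha Y).add (contDiff_const.mul (hb Y))

/-- Each member of the line is local where `a, b` are. -/
theorem isGaugeLocal_lineAct {V : Type*} [NormedAddCommGroup V] [NormedSpace ℝ V]
    {T : ((Fin d → ZMod M) → ℝ) →ₗ[ℝ] V} {a b : Finset (Fin d → ZMod M) → ((Fin d → ZMod M) → ℝ) → ℂ}
    {Y : Finset (Fin d → ZMod M)} (ha : IsGaugeLocal T (a Y)) (hb : IsGaugeLocal T (b Y)) (σ : ℂ) :
    IsGaugeLocal T ((a + σ • b) Y) :=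
  fun φ ψ h => by simp only [lineAct_apply, ha φ ψ h, hb φ ψ h]

/-- `‖c·K‖_k^{(A)} ≤ ‖c‖ C` for a complex constant `c`. -/
theorem weakNormLE_const_mul {P : NormParams d M} {k : ℕ}
    {K : Finset (Fin d → ZMod M) → ((Fin d → ZMod M) → ℝ) → ℂ} {C : ℝ}
    (h : WeakNormLE P k K C) (hK : ∀ X, ContDiff ℝ P.r₀ (K X)) (c : ℂ) :
    WeakNormLE P k (fun X ψ => c * K X ψ) (‖c‖ * C) := fun X hX hc => by
  have := tayNormLE_const_mul (h X hX hc) (hK X) c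
  rw [mul_assoc]
  exact this

/-! ## Lines: weak norm, multiplicative extension -/

/-- `‖a + σ b‖_k ≤ C_a + ‖σ‖ C_b`. -/
theorem weakNormLE_lineAct {P : NormParams d M} {k : ℕ}
    {a b : Finset (Fin d → ZMod M) → ((Fin d → ZMod M) → ℝ) → ℂ} {Ca Cb : ℝ}
    (ha : WeakNormLE P k a Ca) (hb : WeakNormLE P k b Cb)
    (had : ∀ Y, ContDiff ℝ P.r₀ (a Y)) (hbd : ∀ Y, ContDiff ℝ P.r₀ (b Y)) (σ : ℂ) :
    WeakNormLE P k ((a + σ • b)) (Ca + ‖σ‖ * Cb) := by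
  have h := ha.add (weakNormLE_const_mul hb hbd σ) had (fun Y => contDiff_const.mul (hbd Y))
  exact h

omit [NeZero M] in
/-- **`σ ↦ mulExt (a + σ b) (Y, ψ)` is entire** (a finite product of affine functions of `σ`). -/
theorem differentiable_mulExt_lineAct (a b : Finset (Fin d → ZMod M) → ((Fin d → ZMod M) → ℝ) → ℂ)
    (Y : Finset (Fin d → ZMod M)) (ψ : (Fin d → ZMod M) → ℝ) :
    Differentiable ℂ (fun σ : ℂ => mulExt ((a + σ • b)) Y ψ) := by
  simp only [mulExt_apply]
  have h := Differentiable.finsetProd (u := components Y) (f := fun Y' σ => (a + σ • b) Y' ψ)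
    fun Y' _ => differentiable_lineAct a b Y' ψ
  rw [Finset.prod_fn] at h
  exact h

omit [NeZero M] in
/-- On a connected set the extension of the line is the line (affine in `σ`). -/
theorem mulExt_lineAct_of_isConn (a b : Finset (Fin d → ZMod M) → ((Fin d → ZMod M) → ℝ) → ℂ)
    {B : Finset (Fin d → ZMod M)} (hB : IsConn B) (σ : ℂ) :
    mulExt ((a + σ • b)) B = fun ψ => a B ψ + σ * b B ψ := by
  rw [mulExt_of_isConn hB]; rfl

/-! ## The structural pass for a general entire family of activities -/

/-- **`σ ↦ Φ_σ(X, φ, ξ)` is entire** for `I = e^{−(H+σU)}`, `Ĩ = e^{−(H̃+σŨ)}` and ANY activity family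
`σ ↦ 𝒦_σ` that is entire pointwise. -/
theorem differentiable_midK_family (s : ℕ) (H U Ht Ut : RelevantHamiltonian ℂ d)
    (𝒦 : ℂ → Finset (Fin d → ZMod M) → ((Fin d → ZMod M) → ℝ) → ℂ)
    (h𝒦 : ∀ Y ψ, Differentiable ℂ (fun σ => 𝒦 σ Y ψ))
    (X : Finset (Fin d → ZMod M)) (φ ξ : (Fin d → ZMod M) → ℝ) :
    Differentiable ℂ (fun σ : ℂ =>
      midK s (expNegH (H + σ • U)) (expNegH (Ht + σ • Ut)) (𝒦 σ) X φ ξ) := by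
  unfold midK
  refine differentiable_pcirc_param s (F := fun σ Y => bprod s (fun B => 1 - expNegH (Ht + σ • Ut) B φ) Y)
    (G := fun σ Y => pcirc s (bprod s fun B => expNegH (H + σ • U) B (φ + ξ) - 1)
      (fun Y' => 𝒦 σ Y' (φ + ξ)) Y)
    (fun Y => differentiable_bprod_one_sub_expNegH_line s Ht Ut Y φ) (fun Y => ?_) X
  exact differentiable_pcirc_param s (F := fun σ Y' => bprod s (fun B => expNegH (H + σ • U) B (φ + ξ) - 1) Y')
    (G := fun σ Y' => 𝒦 σ Y' (φ + ξ))
    (fun Y' => differentiable_bprod_expNegH_sub_one_line s H U Y' (φ + ξ))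
    (fun Y' => h𝒦 Y' (φ + ξ)) Y

/-- **`K_{k+1} = nextK` is holomorphic along `(H + σU, 𝒦_σ)`** (pointwise in `U', φ`), with the intermediate
Hamiltonian family `H̃ + σŨ`, given measurability and a `σ`-uniform integrable bound of the intermediate functional
`Φ_σ(X, φ, ·)` for every `s`-POLYMER `X`. -/
theorem differentiableOn_nextK_family (s : ℕ) (π : Finset (Fin d → ZMod M) → Finset (Fin d → ZMod M))
    (μ : Measure ((Fin d → ZMod M) → ℝ)) (H U Ht Ut : RelevantHamiltonian ℂ d)
    (𝒦 : ℂ → Finset (Fin d → ZMod M) → ((Fin d → ZMod M) → ℝ) → ℂ)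
    (h𝒦 : ∀ Y ψ, Differentiable ℂ (fun σ => 𝒦 σ Y ψ))
    (U' : Finset (Fin d → ZMod M)) (φ : (Fin d → ZMod M) → ℝ) {R : ℝ}
    (hmeas : ∀ X, IsPolymer s X → ∀ σ, AEStronglyMeasurable (fun ξ =>
      midK s (expNegH (H + σ • U)) (expNegH (Ht + σ • Ut)) (𝒦 σ) X φ ξ) μ)
    (hdom : ∀ X, IsPolymer s X → ∃ G : ((Fin d → ZMod M) → ℝ) → ℝ, Integrable G μ ∧ ∀ σ ∈ ball (0 : ℂ) R, ∀ ξ,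
      ‖midK s (expNegH (H + σ • U)) (expNegH (Ht + σ • Ut)) (𝒦 σ) X φ ξ‖ ≤ G ξ) :
    DifferentiableOn ℂ (fun σ : ℂ =>
      nextK s π μ (expNegH (H + σ • U)) (expNegH (Ht + σ • Ut)) (𝒦 σ) U' φ) (ball (0 : ℂ) R) := by
  unfold nextK
  refine DifferentiableOn.fun_sum fun X hX => ?_
  have hXp : IsPolymer s X := (mem_polys.1 (Finset.mem_filter.1 hX).1).2
  refine DifferentiableOn.mul (DifferentiableOn.mul ?_ ?_) ?_
  · exact (differentiable_bprod_expNegH_line s Ht Ut (U' \ X) φ).differentiableOn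
  · exact (differentiable_bprod_expNegH_inv_line s Ht Ut (X \ U') φ).differentiableOn
  · obtain ⟨G, hGi, hG⟩ := hdom X hXp
    exact differentiableOn_integral_of_dominated_holomorphic (fun σ _ => hmeas X hXp σ)
      (ae_of_all _ fun ξ => (differentiable_midK_family s H U Ht Ut 𝒦 h𝒦 X φ ξ).differentiableOn)
      (ae_of_all _ fun ξ σ hσ => hG σ hσ ξ) hGi

/-- `nextH D H K` depends on `K` only through `K(B₀, ·)`. -/
theorem nextH_congr_B₀ (D : StepData d M) (H : RelevantHamiltonian ℂ d)
    {K K' : Finset (Fin d → ZMod M) → ((Fin d → ZMod M) → ℝ) → ℂ} (h : K D.B₀ = K' D.B₀) :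
    nextH D H K = nextH D H K' := by
  unfold nextH; rw [h]

/-- **The intermediate Hamiltonian along the family is affine**: if `𝒦_σ(B₀) = a(B₀) + σ b(B₀)` then
`nextH D (H + σU) 𝒦_σ = nextH D H a + σ • nextH D U b`. -/
theorem nextH_family (D : StepData d M) (hC : (Matrix.circulant D.𝒞).PosSemidef) (hB : D.B₀.card ≠ 0)
    (hroom : ∀ x ∈ D.B₀, HasRoom D.c₀ x (d / 2 + 1)) (H U : RelevantHamiltonian ℂ d)
    (𝒦 : ℂ → Finset (Fin d → ZMod M) → ((Fin d → ZMod M) → ℝ) → ℂ)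
    {a b : Finset (Fin d → ZMod M) → ((Fin d → ZMod M) → ℝ) → ℂ}
    (h𝒦B₀ : ∀ σ, 𝒦 σ D.B₀ = fun ψ => a D.B₀ ψ + σ * b D.B₀ ψ)
    (hai : ∀ φ, Integrable (fun ξ => a D.B₀ (φ + ξ)) (stepMeasure D.𝒞))
    (hbi : ∀ φ, Integrable (fun ξ => b D.B₀ (φ + ξ)) (stepMeasure D.𝒞))
    (had : ContDiff ℝ 2 (fluct D.𝒞 (a D.B₀))) (hbd : ContDiff ℝ 2 (fluct D.𝒞 (b D.B₀))) (σ : ℂ) :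
    nextH D (H + σ • U) (𝒦 σ) = nextH D H a + σ • nextH D U b := by
  rw [nextH_congr_B₀ D (H + σ • U) (K' := fun Y ψ => a Y ψ + σ * b Y ψ) (h𝒦B₀ σ)]
  exact nextH_line D hC hB hroom H U hai hbi had hbd σ

/-- **`K_{k+1} = nextKStep D H K` is holomorphic along `(H + σU, 𝒦_σ)`** (pointwise in `U', φ`) for an
activity family entire in `σ` and affine on the reference block, under the step-data hypotheses of `nextH_eq`,
integrability / `C²` of the block activities, and measurability plus a `σ`-uniform integrable bound of the
intermediate functional on `s`-polymers. -/
theorem differentiableOn_nextKStep_family (D : StepData d M) (hC : (Matrix.circulant D.𝒞).PosSemidef)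
    (hB : D.B₀.card ≠ 0) (hroom : ∀ x ∈ D.B₀, HasRoom D.c₀ x (d / 2 + 1)) (H U : RelevantHamiltonian ℂ d)
    (𝒦 : ℂ → Finset (Fin d → ZMod M) → ((Fin d → ZMod M) → ℝ) → ℂ)
    (h𝒦 : ∀ Y ψ, Differentiable ℂ (fun σ => 𝒦 σ Y ψ))
    {a b : Finset (Fin d → ZMod M) → ((Fin d → ZMod M) → ℝ) → ℂ}
    (h𝒦B₀ : ∀ σ, 𝒦 σ D.B₀ = fun ψ => a D.B₀ ψ + σ * b D.B₀ ψ)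
    (hai : ∀ φ, Integrable (fun ξ => a D.B₀ (φ + ξ)) (stepMeasure D.𝒞))
    (hbi : ∀ φ, Integrable (fun ξ => b D.B₀ (φ + ξ)) (stepMeasure D.𝒞))
    (had : ContDiff ℝ 2 (fluct D.𝒞 (a D.B₀))) (hbd : ContDiff ℝ 2 (fluct D.𝒞 (b D.B₀)))
    (U' : Finset (Fin d → ZMod M)) (φ : (Fin d → ZMod M) → ℝ) {R : ℝ}
    (hmeas : ∀ X, IsPolymer D.s X → ∀ σ, AEStronglyMeasurable (fun ξ =>
      midK D.s (expNegH (H + σ • U)) (expNegH (nextH D H a + σ • nextH D U b)) (𝒦 σ) X φ ξ) (stepMeasure D.𝒞))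
    (hdom : ∀ X, IsPolymer D.s X → ∃ G : ((Fin d → ZMod M) → ℝ) → ℝ, Integrable G (stepMeasure D.𝒞) ∧
      ∀ σ ∈ ball (0 : ℂ) R, ∀ ξ,
      ‖midK D.s (expNegH (H + σ • U)) (expNegH (nextH D H a + σ • nextH D U b)) (𝒦 σ) X φ ξ‖ ≤ G ξ) :
    DifferentiableOn ℂ (fun σ : ℂ => nextKStep D (H + σ • U) (𝒦 σ) U' φ) (ball (0 : ℂ) R) := by
  have e : ∀ σ : ℂ, nextKStep D (H + σ • U) (𝒦 σ) U' φ
      = nextK D.s (reblock D.s (D.L * D.s)) (stepMeasure D.𝒞) (expNegH (H + σ • U))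
          (expNegH (nextH D H a + σ • nextH D U b)) (𝒦 σ) U' φ := by
    intro σ
    unfold nextKStep
    rw [nextH_family D hC hB hroom H U 𝒦 h𝒦B₀ hai hbi had hbd σ]
  simp only [e]
  exact differentiableOn_nextK_family D.s _ _ H U (nextH D H a) (nextH D U b) 𝒦 h𝒦 U' φ hmeas hdom

end Summit.HubbardSuperconductivity.HubbardSuperconductivity.Theorems.ComplexGFF

end
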